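import Literature.IUT.HodgeTheaters.FKitCoreBridgeWitness
import Literature.IUT.HodgeTheaters.PMBaseSyncIndependenceProofs
import Literature.IUT.HodgeTheaters.PMBaseNegCompatSyncProofs
import HarnessLib

/-!
# [IUTchI] Ex 6.3 (i)/(ii): the laws (α) `PhiEllSync` and (β) `NegCompatModel` are NOT decided by the
# §4/§5 ↔ §6 dictionaries (`KitCore` + `ThetaAgrees` + `FKitCore`) — kernel certificate for row D13-α

S. Mochizuki, *Inter-universal Teichmüller theory I*, kurims manuscript (May 2020), §6: Example 6.3 (i)
pp. 160–161 (the morphism `φ^{Θell}_{•,v}` "determined by the natural composite `X→_v → X_v → X_K`" and the FIXED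
identification `LabCusp^±(𝒟^{⊚±}) ⥲ 𝔽_l`), Example 6.3 (ii) p. 161 ("`φ^{Θell}_±` is equivariant"), Definition
6.1 (iii) p. 157, (v) p. 158 ([IUTchI] Ex 6.3 (i) p.161) [claim: Mochizuki2012, status: disputed] (D-0012 claim key,
series status DISPUTED — this file is a CONSISTENCY / INDEPENDENCE certificate over the cell's own hypothesis
structures; nothing of the series is asserted and no side is taken on [IUTchIII] Cor. 3.12).

## Why this file exists (plan/L5 INSTANCE PROGRAMME D13, row D13-α, abc-iut-L5-lead RULINGS #25 (7))

The α-family (Prop 6.5 (i) s.2) and the β-family (Prop 6.6 (ii)(iii), 6.8 (i), Rmk 6.12.1) of the L5 cone rows are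
conditional on the laws `Ex63.PhiEllSync K` (α, F-2019/F-2029) resp. `Ex63.NegCompatModel K` (β, F-2027/F-2034)
on abc-iut-L5-t4's base kit `K : PMBaseKit l`; abc-iut-L5-t4 / abc-iut-L5-t13 proved them independent of the
kit axioms (`Ex63.exists_kit_not_phiEllSync`, `Ex63.exists_kit_not_equivariant`) and (β) ⇒ (α) for `l` an odd
prime (`Ex63.phiEllSync_of_negCompatModel`, p420660).  Row D13-α asks whether (α) becomes derivable "at
`S5Local.ofDatum`", i.e. once the kit is linked to abc-iut-L5-t3's §4/§5 typings by the dictionaries of the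
intra-layer merge C9-h/C9-i: `BaseThetaDatum.KitCore 𝔡 K` (+ `KitCore.ThetaAgrees`, `KitCoreBridge.lean`),
`S5Local.FKitCore` (`FKitCoreBridge.lean`) — over which `KitCore.NFLink` / `S5Local.ofDatum` /
`IsoKit.ofDatum` (p419751, p420165) add only ΘNF-side data.  ANSWER (this file, kernel-checked): NO — for every
prime `l ≥ 5` there are a §4 datum `𝔡`, a §5-R4 stub `S`, a base kit `K` for `𝔡.l`, a core agreement `c` with
`c.e` BIJECTIVE and `c.ThetaAgrees M`, an `ℱ`-kit `FK` and an `FKitCore` between them, with `𝕍^bad ≠ ∅`, such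
that BOTH laws FAIL (`exists_fKitCore_not_phiEllSync`), and likewise data of the very same shape for which both
laws HOLD (`exists_fKitCore_phiEllSync`).  So the dictionaries (which never mention the `±`-label data
`labPM` / `labOfHom` / `phiEll` / `gChart₀` / `gLabT` of the kit) do not carry the missing input; it lives in the
P5-binding of the kit itself (the Π-avatar instance, abc-iut-L5-t4), in the label-free form of abc-iut-L5-t13:
«at every `v` some lift of `[−1]` to `Aut_±(𝒟^{⊚±})` restricts along `φ^{Θell}_{•,v}` to an automorphism of `𝒟_v`»
(`Ex63.phiEllSync_of_commutes`).

* `Ex63.phiEllSync_thicken_iff`, `Ex63.negCompatModel_thicken` — abc-iut-L5-t3's thickening `PMBaseKit.thicken`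
  (`KitCoreBridgeWitness.lean`, the carrier of the `KitCore`/`FKitCore` inhabitants) reflects (α) and preserves (β):
  all label data are read through the first projection.
* `exists_fKitCore_not_phiEllSync` — the negative instance (abc-iut-L5-t4's translated toy kit, one bad place,
  thickened; `¬(β)` from `¬(α)` by (β) ⇒ (α)).
* `exists_fKitCore_phiEllSync` — the positive instance (abc-iut-L5-t4's toy kit: `Ex63.phiEllSync_toyKit`,
  `Ex63.negCompatModel_toyKit`).

PROOF-ONLY (no definition, no instance, no notation); universe `0` (the universe of the witness kits).
typed ≠ proved elsewhere; nothing here bears on [IUTchIII] Cor. 3.12.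
-/

namespace Literature.IUT.HodgeTheaters

open CategoryTheory

namespace PMBaseKit

variable {l : ℕ}

namespace Ex63

/-- **Thickening reflects and preserves the synchronisation law (α)**: every `±`-label datum of `K.thicken`
(abc-iut-L5-t3's `PMBaseKit.thicken`) is the corresponding datum of `K` read through the first projection, so
`PhiEllSync K.thicken` and `PhiEllSync K` are the same statement.
([IUTchI] Ex 6.3 (i) p.161) [claim: Mochizuki2012, status: disputed] -/
theorem phiEllSync_thicken_iff (K : PMBaseKit.{0} l) : PhiEllSync K.thicken ↔ PhiEllSync K :=
  Iff.rfl

/-- **Thickening preserves the `[−1]`-compatibility law (β)**: a negative automorphism `a` of `𝒟_v` and a lift `b`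
of `(0, −1)` with `a ≫ φ^{Θell}_{•,v} = φ^{Θell}_{•,v} ≫ b` give `(a, 𝟙)` and the same `b` for the thickened kit.
([IUTchI] Ex 6.3 (ii) p.161) [claim: Mochizuki2012, status: disputed] -/
theorem negCompatModel_thicken {K : PMBaseKit.{0} l} (h : NegCompatModel K) : NegCompatModel K.thicken := by
  intro v
  obtain ⟨a, ha, b, hb, hab⟩ := h v
  refine ⟨Iso.prod a (Iso.refl Thick.pt), ?_, b, hb, ?_⟩
  · have h1 : (CategoryTheory.Prod.fst _ _).mapIso (Iso.prod a (Iso.refl Thick.pt)) = a := by ext; rfl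
    change K.labMap v ((CategoryTheory.Prod.fst _ _).mapIso (Iso.prod a (Iso.refl Thick.pt))) = _
    rw [h1]
    exact ha
  · exact Prod.ext hab rfl

end Ex63

/-- **Row D13-α, negative instance: `KitCore` + `ThetaAgrees` + `FKitCore` do NOT imply (α) or (β).**  For every
prime `l ≥ 5` there exist a §4 datum `𝔡` with `𝔡.l = l`, a §5-R4 stub `S` over it, a §6 base kit `K`, a core
agreement `c : KitCore 𝔡 K` with `c.e` bijective and `c.ThetaAgrees M` for a multiplicative kit `M`, an `ℱ`-kit
`FK` and an `FKitCore` between `S` and `FK`, with `𝕍^bad ≠ ∅`, such that the synchronisation law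
`Ex63.PhiEllSync K` of Example 6.3 (i) and the `[−1]`-compatibility law `Ex63.NegCompatModel K` of Example 6.3 (ii)
BOTH FAIL (abc-iut-L5-t4's translated toy kit — `φ^{Θell}_{•,v} = (z ↦ z + 1)` on cusps — given one bad place and
thickened by abc-iut-L5-t3's `thickDatum` / `thickCore` / `thickS5Local` / `thickFKitCore`).
([IUTchI] Ex 6.3 (i) p.161) [claim: Mochizuki2012, status: disputed] -/
theorem exists_fKitCore_not_phiEllSync (l : ℕ) [Fact l.Prime] (hl5 : 5 ≤ l) :
    ∃ (𝔡 : BaseThetaDatum.{0}) (S : 𝔡.S5Local) (K : PMBaseKit.{0} 𝔡.l) (c : 𝔡.KitCore K) (M : K.MultKit)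
      (FK : K.FKit M) (_ : S.FKitCore c FK),
      𝔡.l = l ∧ c.ThetaAgrees M ∧ Function.Bijective c.e ∧ K.bad.Nonempty ∧
        ¬ Ex63.PhiEllSync K ∧ ¬ Ex63.NegCompatModel K := by
  classical
  have hl2 : l ≠ 2 := by omega
  obtain ⟨K₀, ⟨v₀⟩, hK₀⟩ := Ex63.exists_kit_not_phiEllSync l hl2
  let K₁ : PMBaseKit.{0} l := { K₀ with bad := ({v₀} : Finset K₀.V), arc := ∅ }
  have hdis : Disjoint K₁.bad K₁.arc := Finset.disjoint_empty_right _
  have hbad : K₁.bad.Nonempty := ⟨v₀, Finset.mem_singleton_self _⟩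
  have h1 : ¬ Ex63.PhiEllSync K₁ := hK₀
  have h2 : ¬ Ex63.PhiEllSync K₁.thicken := fun h => h1 ((Ex63.phiEllSync_thicken_iff K₁).1 h)
  have h3 : ¬ Ex63.NegCompatModel K₁.thicken := fun h => h2 (Ex63.phiEllSync_of_negCompatModel hl2 h)
  exact ⟨K₁.thickDatum hl5 hdis hbad, K₁.thickS5Local hl5 hdis hbad, K₁.thicken, K₁.thickCore hl5 hdis hbad,
    K₁.thickMultKit hl5 hdis hbad, FKit.ofBase K₁.thicken _, K₁.thickFKitCore hl5 hdis hbad _, rfl,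
    K₁.thickCore_thetaAgrees hl5 hdis hbad, K₁.thickCore_e_bijective hl5 hdis hbad, hbad, h2, h3⟩

/-- **Row D13-α, positive instance: data of the very same shape for which (α) and (β) HOLD** — abc-iut-L5-t4's toy
kit itself (`Ex63.phiEllSync_toyKit`, `Ex63.negCompatModel_toyKit`), one bad place, thickened.  Together with
`exists_fKitCore_not_phiEllSync`: the laws are INDEPENDENT of `KitCore` + `ThetaAgrees` + `FKitCore`.
([IUTchI] Ex 6.3 (i) p.161) [claim: Mochizuki2012, status: disputed] -/
theorem exists_fKitCore_phiEllSync (l : ℕ) [Fact l.Prime] (hl5 : 5 ≤ l) :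
    ∃ (𝔡 : BaseThetaDatum.{0}) (S : 𝔡.S5Local) (K : PMBaseKit.{0} 𝔡.l) (c : 𝔡.KitCore K) (M : K.MultKit)
      (FK : K.FKit M) (_ : S.FKitCore c FK),
      𝔡.l = l ∧ c.ThetaAgrees M ∧ Function.Bijective c.e ∧ K.bad.Nonempty ∧
        Ex63.PhiEllSync K ∧ Ex63.NegCompatModel K := by
  classical
  have hl2 : l ≠ 2 := by omega
  let K₁ : PMBaseKit.{0} l := { toyKit l hl2 with bad := ({PUnit.unit} : Finset Unit), arc := ∅ }
  have hdis : Disjoint K₁.bad K₁.arc := Finset.disjoint_empty_right _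
  have hbad : K₁.bad.Nonempty := ⟨PUnit.unit, Finset.mem_singleton_self _⟩
  have h1 : Ex63.PhiEllSync K₁ := Ex63.phiEllSync_toyKit l hl2
  have h2 : Ex63.PhiEllSync K₁.thicken := (Ex63.phiEllSync_thicken_iff K₁).2 h1
  have h3 : Ex63.NegCompatModel K₁ := Ex63.negCompatModel_toyKit l hl2
  have h4 : Ex63.NegCompatModel K₁.thicken := Ex63.negCompatModel_thicken h3
  exact ⟨K₁.thickDatum hl5 hdis hbad, K₁.thickS5Local hl5 hdis hbad, K₁.thicken, K₁.thickCore hl5 hdis hbad,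
    K₁.thickMultKit hl5 hdis hbad, FKit.ofBase K₁.thicken _, K₁.thickFKitCore hl5 hdis hbad _, rfl,
    K₁.thickCore_thetaAgrees hl5 hdis hbad, K₁.thickCore_e_bijective hl5 hdis hbad, hbad, h2, h4⟩

/-- The two instances at `l = 5`. ([IUTchI] Ex 6.3 (i) p.161) [claim: Mochizuki2012, status: disputed] -/
theorem exists_fKitCore_not_phiEllSync_five :
    ∃ (𝔡 : BaseThetaDatum.{0}) (S : 𝔡.S5Local) (K : PMBaseKit.{0} 𝔡.l) (c : 𝔡.KitCore K) (M : K.MultKit)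
      (FK : K.FKit M) (_ : S.FKitCore c FK),
      𝔡.l = 5 ∧ c.ThetaAgrees M ∧ Function.Bijective c.e ∧ K.bad.Nonempty ∧
        ¬ Ex63.PhiEllSync K ∧ ¬ Ex63.NegCompatModel K :=
  haveI : Fact (Nat.Prime 5) := ⟨Nat.prime_five⟩
  exists_fKitCore_not_phiEllSync 5 le_rfl

end PMBaseKit

end Literature.IUT.HodgeTheaters
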